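import Mathlib
import Summits.HodgeConjecture.HodgeConjecture.Theorems.HodgeLocusCensusUnitColumnRankD3

/-!
# HodgeLocus census — THEOREM K-MODEL, `d = 3`: the characteristic-`2` / `3` DEFICIT table of anchor 179 as kernel theorems (ENGINE B, B48-N)

certified instances and evidence bearing on the general Hodge conjecture; no claim.

SETTING.  Anchor 179 (`HodgeLocusCensusUnitColumnRankD3`) certifies MAXIMAL RANK of `×ℓ^{c′} : B_{k−3} → B_{k+c′−3}` (`c′ = 1, 2, 3`) on the Boolean model
`B = K[x₁,…,x_k]/(x₁²,…,x_k²)` of the `d = 3` cells whenever `2` and `3` are units of `K`, and records the exact ranks over `GF(2)` / `GF(3)` under NECESSITY as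
checked numerics only.  This sheet proves that table about the SAME matrices: the statements copy the three matrices of THEOREMS (i)–(iii) of anchor 179 verbatim
(rows = target monomials `{v // Σ v_i + j = k·1}`, columns = sources `{m // Σ m_i + 3 = k·1}`, entries read off gen 31's `colR 3`; `card rows = C(k,j)`, `card_level`).

THEOREMS (kernel statements; `K` a field).
 (N1) `rank_mulL_modelC1_d3_char_three`  — `(3 : K) = 0`, `k ≥ 5`:  `rank (×ℓ) + 1 = card rows`        (rank `C(k,2) − 1`);
 (N2) `rank_mulL_modelC1_d3_char_two`    — `(2 : K) = 0`, `k ≥ 1`:  `rank (×ℓ) + (k − 1) = card rows`  (rank `C(k−1,2)`);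
 (N3) `rank_mulL2_modelC1_d3_char_three` — `(3 : K) = 0`, `k ≥ 4`:  `rank (×ℓ²) + 1 = card rows`       (rank `k − 1`);
 (N4) `mulL2_modelC1_d3_char_two`        — `(2 : K) = 0`, every `k`: the matrix of `×ℓ²` is `0`         (`ℓ² = 2·e₂(x)`; rank `0` by `Matrix.rank_zero`);
 (N5) `mulL3_modelC1_d3_six`             — `(6 : K) = 0`, every `k`: the matrix of `×ℓ³` is `0`         (`ℓ³ = 6·e₃(x)`).
With anchor 179 (whose cells (i) `k = 3, 4` and (ii) `k = 3` ask only `2` a unit, or nothing) every `d = 3` cell has its exact rank in EVERY characteristic as a kernel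
theorem, and each unit hypothesis of anchor 179 is necessary as a theorem; the thresholds are sharp ((N1) fails at `k = 4`: rank `4 = C(4,2) − 2`; (N3) at `k = 3`: rank `1`).

METHOD (minor-free: LAYER A‴ = three generic lemmas, then the column identities `col_one_eq` / `col_two_eq` of anchor 179 read in both directions; no `decide`).
 UPPER `rank + card ι ≤ card rows` from `card ι` independent LEFT-KERNEL vectors (`rank_add_card_le_of_vecMul_eq_zero`, rank–nullity for `Aᵀ`; independence by
 private coordinates, `linearIndependent_of_apply_ne_zero`): (N1) the all-ones vector, every column `χ_{bc} + χ_{ac} + χ_{ab}` of `×ℓ` having three entries `1`;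
 (N3) likewise, every column `2(χ_a + χ_b + χ_c)` of `×ℓ²` summing to `6`; (N2) for each index `a ≠ z` (`z` fixed) the vector `y^a := Σ_{P ∋ a} e_P`, with
 `y^a · col_T = #{P ⊂ T : |P| = 2, a ∈ P} ∈ {0, 2}` and `y^a` alone nonzero at the row `{a, z}`.
 LOWER `card rows ≤ rank + card ι` when every unit vector lies in `span cols + span (hub ι)` (`card_le_rank_add_card_of_single_mem_sup`, a dimension count):
 (N1) hub `e_{P₀}` — for distinct `a,b,c,d`, `2(χ_{ab} − χ_{cd}) = col_{abc} + col_{abd} − col_{acd} − col_{bcd}` (`sub_mem_of_four_triples`, tactic `module`; `2` is a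
 unit as `3 = 0`), and two meeting pairs are linked through a pair `{u,w}` outside both (`k ≥ 5`); (N3) `2(χ_d − χ_{d′}) = col_{abd} − col_{abd′}`, `a, b ∉ {d, d′}`
 (`k ≥ 4`); (N2) hubs `e_{{a,z}}`, `a ≠ z` — a row through `z` is a hub, a row `{a,b} ∌ z` is `col_{abz} − χ_{bz} − χ_{az}`.  (N4)/(N5) entrywise: `col_two_eq`, and
 `ℓ³·x^{𝟙_{abc}}` lists `x₁⋯x_k` exactly `3! = 6` times for EVERY source (`count_flatMap3_all`; anchor 179's `count_flatMap3` is the source `{0,1,2}`).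
SCOPE (said plainly).  Explicit matrices read off gen 31's `colR`; that their ranks are the `ρ` of THEOREM K-MODEL is the record's step (outside Lean, as in the
anchors).  Evidence-class upgrade (numerics → theorems) of anchor 179's NECESSITY table; no census number changes; nothing about HC.  Second implementation:
`check_deficit.py` (exact ranks over `GF(2)` / `GF(3)` / `ℚ`, `k = 2..12`, and each identity above, read from the statement text).
-/

set_option linter.dupNamespace false
set_option autoImplicit false

namespace Summit.HodgeConjecture.HodgeConjecture.HodgeLocus.Census.UnitColumnRankD3Deficit

open Module
open Summit.HodgeConjecture.HodgeConjecture.HodgeLocus.Census.ModelNonJumpC1All (colR)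
open Summit.HodgeConjecture.HodgeConjecture.HodgeLocus.Census.UnitColumnRankD4 (colR_nodup)
open Summit.HodgeConjecture.HodgeConjecture.HodgeLocus.Census.UnitColumnRankD3

/-! ## LAYER A‴ — three generic rank lemmas -/

/-- LEFT-KERNEL BOUND: `card ι` linearly independent row vectors `y i` with `y i ᵥ* A = 0` force `rank A + card ι ≤ card m` (rank–nullity for `Aᵀ`). -/
theorem rank_add_card_le_of_vecMul_eq_zero {K : Type*} [Field K] {m n ι : Type*} [Fintype m] [Fintype n] [Fintype ι]
    (A : Matrix m n K) (y : ι → (m → K)) (hy : LinearIndependent K y) (h0 : ∀ i, Matrix.vecMul (y i) A = 0) :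
    A.rank + Fintype.card ι ≤ Fintype.card m := by
  have hker : ∀ i, y i ∈ LinearMap.ker (A.transpose.mulVecLin) := fun i => by
    rw [LinearMap.mem_ker, Matrix.mulVecLin_apply, Matrix.mulVec_transpose, h0 i]
  have h1 : Fintype.card ι ≤ finrank K (LinearMap.ker A.transpose.mulVecLin) := by
    have hz : LinearIndependent K (fun i => (⟨y i, hker i⟩ : LinearMap.ker A.transpose.mulVecLin)) :=
      LinearIndependent.of_comp (LinearMap.ker A.transpose.mulVecLin).subtype (by exact hy)
    exact hz.fintype_card_le_finrank
  have h2 := LinearMap.finrank_range_add_finrank_ker (A.transpose.mulVecLin); rw [Module.finrank_fintype_fun_eq_card] at h2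
  have h3 : A.rank = finrank K (LinearMap.range A.transpose.mulVecLin) := by rw [← Matrix.rank_transpose]; rfl
  omega

/-- … one nonzero left-kernel vector: `rank A + 1 ≤ card m` -/
theorem rank_add_one_le_card_of_vecMul_eq_zero {K : Type*} [Field K] {m n : Type*} [Fintype m] [Fintype n]
    (A : Matrix m n K) (y : m → K) (hy : y ≠ 0) (h0 : Matrix.vecMul y A = 0) : A.rank + 1 ≤ Fintype.card m := by
  simpa using rank_add_card_le_of_vecMul_eq_zero (ι := Unit) A (fun _ => y) (linearIndependent_unique_iff.mpr hy) (fun _ => h0)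

/-- HUB BOUND: if every unit vector lies in `span (cols A) ⊔ span (h ι)` then `card m ≤ rank A + card ι` (dimension count). -/
theorem card_le_rank_add_card_of_single_mem_sup {K : Type*} [Field K] {m n ι : Type*} [Fintype m] [Fintype n] [Fintype ι] [DecidableEq m]
    (A : Matrix m n K) (h : ι → (m → K))
    (hmem : ∀ s : m, (Pi.single s (1 : K) : m → K) ∈ Submodule.span K (Set.range A.col) ⊔ Submodule.span K (Set.range h)) :
    Fintype.card m ≤ A.rank + Fintype.card ι := by
  have htop : (⊤ : Submodule K (m → K)) ≤ Submodule.span K (Set.range A.col) ⊔ Submodule.span K (Set.range h) := by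
    rw [← (Pi.basisFun K m).span_eq, Submodule.span_le]
    rintro _ ⟨s, rfl⟩; rw [Pi.basisFun_apply]; exact hmem s
  have h1 := Submodule.finrank_mono htop; rw [finrank_top, Module.finrank_fintype_fun_eq_card] at h1
  have h2 := Submodule.finrank_add_le_finrank_add_finrank (Submodule.span K (Set.range A.col)) (Submodule.span K (Set.range h))
  have h3 : finrank K (Submodule.span K (Set.range h)) ≤ Fintype.card ι := finrank_range_le_card h
  rw [Matrix.rank_eq_finrank_span_cols]; omega

/-- … one hub vector: if all differences of unit vectors lie in the column span then `card m ≤ rank A + 1` -/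
theorem card_le_rank_add_one_of_sub_mem {K : Type*} [Field K] {m n : Type*} [Fintype m] [Fintype n] [DecidableEq m] (A : Matrix m n K)
    (hsub : ∀ s t : m, (Pi.single s (1 : K) : m → K) - Pi.single t 1 ∈ Submodule.span K (Set.range A.col)) : Fintype.card m ≤ A.rank + 1 := by
  rcases isEmpty_or_nonempty (α := m) with hm | hm
  · simp
  · obtain ⟨t⟩ := hm
    have ht : (Pi.single t (1 : K) : m → K) ∈ Submodule.span K (Set.range fun _ : Unit => (Pi.single t (1 : K) : m → K)) :=
      Submodule.subset_span ⟨(), rfl⟩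
    exact card_le_rank_add_card_of_single_mem_sup (ι := Unit) A (fun _ => Pi.single t 1) fun s => by simpa using Submodule.add_mem_sup (hsub s t) ht

/-- PRIVATE COORDINATES: vectors `x i` with `x i (r i) ≠ 0` and `x j (r i) = 0` for `j ≠ i` are linearly independent. -/
theorem linearIndependent_of_apply_ne_zero {K : Type*} [Field K] {m ι : Type*} [Fintype ι] (x : ι → (m → K)) (r : ι → m)
    (hdiag : ∀ i, x i (r i) ≠ 0) (hoff : ∀ i j, j ≠ i → x j (r i) = 0) : LinearIndependent K x := by
  refine Fintype.linearIndependent_iff.mpr fun g hg i => ?_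
  have h := congrFun hg (r i)
  rw [Finset.sum_apply, Finset.sum_eq_single i (fun j _ hj => by rw [Pi.smul_apply, hoff i j hj, smul_zero]) (fun hi => absurd (Finset.mem_univ i) hi),
    Pi.smul_apply, Pi.zero_apply, smul_eq_mul] at h
  exact (mul_eq_zero.mp h).resolve_right (hdiag i)

/-! ## Two inversion identities over `ℤ[1/2]`; levels, zero sets and column lists (complements to anchor 179) -/

/-- four triple columns on four points `{a,b,c,d}` give `χ_{ab} − χ_{cd}` when `2` is a unit (`xyz ↦ yz + xz + xy`) -/
theorem sub_mem_of_four_triples {K M : Type*} [Field K] [AddCommGroup M] [Module K M] (h2 : (2 : K) ≠ 0) (S : Submodule K M) {ab ac ad bc bd cd : M}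
    (habc : bc + ac + ab ∈ S) (habd : bd + ad + ab ∈ S) (hacd : cd + ad + ac ∈ S) (hbcd : cd + bd + bc ∈ S) : ab - cd ∈ S := by
  refine (Submodule.smul_mem_iff S h2).mp ?_
  have e : (2 : K) • (ab - cd) = (bc + ac + ab) + (bd + ad + ab) - (cd + ad + ac) - (cd + bd + bc) := by module
  rw [e]; exact S.sub_mem (S.sub_mem (S.add_mem habc habd) hacd) hbcd

/-- two triple columns through `{a,b}` give `χ_d − χ_{d′}` when `2` is a unit (`xyz ↦ 2(x + y + z)`) -/
theorem sub_mem_of_two_triples {K M : Type*} [Field K] [AddCommGroup M] [Module K M] (h2 : (2 : K) ≠ 0) (S : Submodule K M) {a b d d' : M}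
    (habd : (2 : K) • (a + b + d) ∈ S) (habd' : (2 : K) • (a + b + d') ∈ S) : d - d' ∈ S := by
  refine (Submodule.smul_mem_iff S h2).mp ?_
  have e : (2 : K) • (d - d') = (2 : K) • (a + b + d) - (2 : K) • (a + b + d') := by module
  rw [e]; exact S.sub_mem habd habd'

/-- `2` is a unit in characteristic `3` -/
theorem two_ne_zero_of_three_eq_zero {K : Type*} [Field K] (h3 : (3 : K) = 0) : (2 : K) ≠ 0 :=
  fun h2 => one_ne_zero (by linear_combination h3 - h2 : (1 : K) = 0)

/-- the mass of `𝟙_{a}` -/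
theorem sum_ind_one {k : ℕ} (a : Fin k) : (∑ l : Fin k, ((if l ∈ ({a} : Finset (Fin k)) then (0 : Fin 2) else 1 : Fin 2) : ℕ)) + 1 = k * 1 := by
  have h := sum_ind ({a} : Finset (Fin k)); rwa [Finset.card_singleton] at h

/-- the mass of `𝟙_{ab}` -/
theorem sum_ind_two {k : ℕ} (a b : Fin k) (hab : a ≠ b) :
    (∑ l : Fin k, ((if l ∈ ({a, b} : Finset (Fin k)) then (0 : Fin 2) else 1 : Fin 2) : ℕ)) + 2 = k * 1 := by
  have h := sum_ind ({a, b} : Finset (Fin k)); rwa [Finset.card_pair hab] at h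

/-- the monomials of `B_{k−3}` (the sources): three zero exponents -/
theorem col_shape_three {k : ℕ} (m : Fin k → Fin 2) (hm : (∑ i, (m i : ℕ)) + 3 = k * 1) :
    ∃ a b c : Fin k, a ≠ b ∧ a ≠ c ∧ b ≠ c ∧ m = fun l => if l ∈ ({a, b, c} : Finset (Fin k)) then (0 : Fin 2) else 1 := by
  obtain ⟨a, b, c, hab, hac, hbc, h⟩ := Finset.card_eq_three.mp (card_filter_eq m hm)
  exact ⟨a, b, c, hab, hac, hbc, (eq_ind_filter m).trans (by rw [h])⟩

/-- the monomial of `B_k`: no zero exponent -/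
theorem row_shape_zero {k : ℕ} (v : Fin k → Fin 2) (hv : (∑ i, (v i : ℕ)) = k * 1) : v = fun _ => 1 := by
  have h := card_filter_eq (j := 0) v (by simpa using hv); rw [Finset.card_eq_zero] at h
  exact (eq_ind_filter v).trans (by rw [h]; funext l; simp)

/-- two indices outside a small set -/
theorem exists_two_not_mem {k : ℕ} (S : Finset (Fin k)) (h : S.card + 2 ≤ k) : ∃ u w : Fin k, u ∉ S ∧ w ∉ S ∧ u ≠ w := by
  have hcard : 1 < (Finset.univ \ S).card := by rw [Finset.card_univ_sdiff, Fintype.card_fin]; omega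
  obtain ⟨u, hu, w, hw, huw⟩ := Finset.one_lt_card.mp hcard
  simp only [Finset.mem_sdiff, Finset.mem_univ, true_and] at hu hw; exact ⟨u, w, hu, hw, huw⟩

/-- `k − 1` indices differ from a fixed one -/
theorem card_ne_eq {k : ℕ} (z : Fin k) : Fintype.card {a : Fin k // a ≠ z} = k - 1 := by
  rw [Fintype.card_subtype_compl, Fintype.card_fin, Fintype.card_subtype_eq]

/-- the sum over a level of the indicator of one of its members is `1` … -/
theorem sum_ite_eq_one {K : Type*} [Field K] {k j : ℕ} (f : Fin k → Fin 2) (hf : (∑ i, (f i : ℕ)) + j = k * 1) :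
    (∑ v : {v : Fin k → Fin 2 // (∑ i, (v i : ℕ)) + j = k * 1}, (if v.1 = f then (1 : K) else 0)) = 1 := by
  rw [Finset.sum_eq_single ⟨f, hf⟩ (fun v _ hv => if_neg fun h => hv (Subtype.ext h)) (fun h => absurd (Finset.mem_univ _) h), if_pos rfl]

/-- … and weighted by `y` it is `y` there -/
theorem sum_mul_ite_eq {K : Type*} [Field K] {k j : ℕ} (y : {v : Fin k → Fin 2 // (∑ i, (v i : ℕ)) + j = k * 1} → K) (f : Fin k → Fin 2)
    (hf : (∑ i, (f i : ℕ)) + j = k * 1) :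
    (∑ v : {v : Fin k → Fin 2 // (∑ i, (v i : ℕ)) + j = k * 1}, y v * (if v.1 = f then (1 : K) else 0)) = y ⟨f, hf⟩ := by
  rw [Finset.sum_eq_single ⟨f, hf⟩ (fun v _ hv => by rw [if_neg fun h => hv (Subtype.ext h), mul_zero]) (fun h => absurd (Finset.mem_univ _) h),
    if_pos rfl, mul_one]

/-- the `×ℓ` entry at a source with zero set `{a,b,c}`: `χ_{bc} + χ_{ac} + χ_{ab}` (anchor 179's `col_one_eq`, the source given by an equation) -/
theorem entry_one_eq {K : Type*} [Field K] {k : ℕ} (m : Fin k → Fin 2) (a b c : Fin k) (hab : a ≠ b) (hac : a ≠ c) (hbc : b ≠ c)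
    (hm : m = fun l => if l ∈ ({a, b, c} : Finset (Fin k)) then (0 : Fin 2) else 1) (w : Fin k → Fin 2) :
    (if List.ofFn (fun i => (w i : ℕ)) ∈ colR 3 (List.ofFn fun i => (m i : ℕ)) then (1 : K) else 0) =
      (if w = (fun l => if l ∈ ({b, c} : Finset (Fin k)) then (0 : Fin 2) else 1) then (1 : K) else 0) +
      (if w = (fun l => if l ∈ ({a, c} : Finset (Fin k)) then (0 : Fin 2) else 1) then (1 : K) else 0) +
      (if w = (fun l => if l ∈ ({a, b} : Finset (Fin k)) then (0 : Fin 2) else 1) then (1 : K) else 0) := by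
  subst hm; exact col_one_eq a b c hab hac hbc w

/-- the `×ℓ²` entry at a source with zero set `{a,b,c}`: `2(χ_a + χ_b + χ_c)` (anchor 179's `col_two_eq`) -/
theorem entry_two_eq {K : Type*} [Field K] {k : ℕ} (m : Fin k → Fin 2) (a b c : Fin k) (hab : a ≠ b) (hac : a ≠ c) (hbc : b ≠ c)
    (hm : m = fun l => if l ∈ ({a, b, c} : Finset (Fin k)) then (0 : Fin 2) else 1) (w : Fin k → Fin 2) :
    ((((colR 3 (List.ofFn fun i => (m i : ℕ))).flatMap (colR 3)).count (List.ofFn fun i => (w i : ℕ)) : ℕ) : K) =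
      (2 : K) • ((if w = (fun l => if l ∈ ({a} : Finset (Fin k)) then (0 : Fin 2) else 1) then (1 : K) else 0) +
      (if w = (fun l => if l ∈ ({b} : Finset (Fin k)) then (0 : Fin 2) else 1) then (1 : K) else 0) +
      (if w = (fun l => if l ∈ ({c} : Finset (Fin k)) then (0 : Fin 2) else 1) then (1 : K) else 0)) := by
  subst hm; exact col_two_eq a b c hab hac hbc w

/-- the column list of `𝟙_{ab}` is a permutation of `[ofFn 𝟙_{b}, ofFn 𝟙_{a}]` -/
theorem perm_colR_ind_two {k : ℕ} (a b : Fin k) (hab : a ≠ b) :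
    (colR 3 (List.ofFn fun l => ((if l ∈ ({a, b} : Finset (Fin k)) then (0 : Fin 2) else 1 : Fin 2) : ℕ))).Perm
      [List.ofFn fun l => ((if l ∈ ({b} : Finset (Fin k)) then (0 : Fin 2) else 1 : Fin 2) : ℕ),
       List.ofFn fun l => ((if l ∈ ({a} : Finset (Fin k)) then (0 : Fin 2) else 1 : Fin 2) : ℕ)] := by
  refine (List.perm_ext_iff_of_nodup (colR_nodup 3 le_rfl _) ?_).mpr fun x => ?_
  · refine List.nodup_cons.mpr ⟨?_, List.nodup_singleton _⟩
    simp only [List.mem_cons, List.not_mem_nil, or_false, ofFn_val_inj]; exact ind_ne _ _ a (by simp [hab]) (by simp)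
  · rw [mem_colR_ind_two_iff a b hab]; simp

/-- the column list of `𝟙_{abc}` is a permutation of `[ofFn 𝟙_{bc}, ofFn 𝟙_{ac}, ofFn 𝟙_{ab}]` (the `hperm` inside anchor 179's `col_two_eq`) -/
theorem perm_colR_ind_three {k : ℕ} (a b c : Fin k) (hab : a ≠ b) (hac : a ≠ c) (hbc : b ≠ c) :
    (colR 3 (List.ofFn fun l => ((if l ∈ ({a, b, c} : Finset (Fin k)) then (0 : Fin 2) else 1 : Fin 2) : ℕ))).Perm
      [List.ofFn fun l => ((if l ∈ ({b, c} : Finset (Fin k)) then (0 : Fin 2) else 1 : Fin 2) : ℕ),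
       List.ofFn fun l => ((if l ∈ ({a, c} : Finset (Fin k)) then (0 : Fin 2) else 1 : Fin 2) : ℕ),
       List.ofFn fun l => ((if l ∈ ({a, b} : Finset (Fin k)) then (0 : Fin 2) else 1 : Fin 2) : ℕ)] := by
  refine (List.perm_ext_iff_of_nodup (colR_nodup 3 le_rfl _) ?_).mpr fun x => ?_
  · refine List.nodup_cons.mpr ⟨?_, List.nodup_cons.mpr ⟨?_, List.nodup_singleton _⟩⟩
    · simp only [List.mem_cons, List.not_mem_nil, or_false, ofFn_val_inj, not_or]
      exact ⟨ind_ne _ _ a (by simp [hab, hac]) (by simp), ind_ne _ _ a (by simp [hab, hac]) (by simp)⟩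
    · simp only [List.mem_cons, List.not_mem_nil, or_false, ofFn_val_inj]
      exact ind_ne _ _ b (by simp [Ne.symm hab, hbc]) (by simp)
  · rw [mem_colR_ind_three_iff a b c hab hac hbc]; simp

/-- `ℓ · x^{[k] ∖ a} = x₁⋯x_k`: the column list of `𝟙_{a}` counts the all-ones exponent function once -/
theorem count_colR_ind_one {k : ℕ} (a : Fin k) :
    (colR 3 (List.ofFn fun l => ((if l ∈ ({a} : Finset (Fin k)) then (0 : Fin 2) else 1 : Fin 2) : ℕ))).count
      (List.ofFn fun l : Fin k => (((fun _ => 1 : Fin k → Fin 2) l : Fin 2) : ℕ)) = 1 := by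
  refine List.count_eq_one_of_mem (colR_nodup 3 le_rfl _) ?_
  rw [mem_colR_ind_iff]; exact ⟨a, Finset.mem_singleton_self a, by simp⟩

/-- `ℓ³ · x^{𝟙_{abc}} = 6 · x₁⋯x_k` for EVERY source zero set `{a,b,c}` -/
theorem count_flatMap3_all {k : ℕ} (a b c : Fin k) (hab : a ≠ b) (hac : a ≠ c) (hbc : b ≠ c) :
    ((((colR 3 (List.ofFn fun l => ((if l ∈ ({a, b, c} : Finset (Fin k)) then (0 : Fin 2) else 1 : Fin 2) : ℕ))).flatMap (colR 3)).flatMap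
        (colR 3)).count (List.ofFn fun l : Fin k => (((fun _ => 1 : Fin k → Fin 2) l : Fin 2) : ℕ))) = 6 := by
  rw [(((perm_colR_ind_three a b c hab hac hbc).flatMap_right (colR 3)).flatMap_right (colR 3)).count_eq]
  simp only [List.flatMap_cons, List.flatMap_nil, List.append_nil, List.flatMap_append, List.count_append,
    ((perm_colR_ind_two b c hbc).flatMap_right (colR 3)).count_eq, ((perm_colR_ind_two a c hac).flatMap_right (colR 3)).count_eq,
    ((perm_colR_ind_two a b hab).flatMap_right (colR 3)).count_eq, count_colR_ind_one, Nat.reduceAdd]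

/-! ## THE `d = 3` CELLS IN CHARACTERISTIC `3` -/

/-- (N1)  `(3 : K) = 0`, `k ≥ 5`: the indicator matrix of `×ℓ : B_{k−3} → B_{k−2}` (THEOREM (i) of anchor 179) has rank `card rows − 1`. -/
theorem rank_mulL_modelC1_d3_char_three (K : Type*) [Field K] (h3 : (3 : K) = 0) (k : ℕ) (hk : 5 ≤ k) :
    (Matrix.of fun (v : {v : Fin k → Fin 2 // (∑ i, (v i : ℕ)) + 2 = k * 1}) (m : {m : Fin k → Fin 2 // (∑ i, (m i : ℕ)) + 3 = k * 1}) =>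
      if List.ofFn (fun i => (v.1 i : ℕ)) ∈ colR 3 (List.ofFn (fun i => (m.1 i : ℕ))) then (1 : K) else 0).rank + 1 =
      Fintype.card {v : Fin k → Fin 2 // (∑ i, (v i : ℕ)) + 2 = k * 1} := by
  set A := (Matrix.of fun (v : {v : Fin k → Fin 2 // (∑ i, (v i : ℕ)) + 2 = k * 1}) (m : {m : Fin k → Fin 2 // (∑ i, (m i : ℕ)) + 3 = k * 1}) =>
      if List.ofFn (fun i => (v.1 i : ℕ)) ∈ colR 3 (List.ofFn (fun i => (m.1 i : ℕ))) then (1 : K) else 0) with hA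
  have h2 : (2 : K) ≠ 0 := two_ne_zero_of_three_eq_zero h3
  -- the column at the source `x^{𝟙_{xyz}}` is `χ_{yz} + χ_{xz} + χ_{xy}` (as in anchor 179)
  have hmem : ∀ x y z : Fin k, x ≠ y → x ≠ z → y ≠ z →
      ((fun w => if w.1 = (fun l => if l ∈ ({y, z} : Finset (Fin k)) then (0 : Fin 2) else 1) then (1 : K) else 0) +
        (fun w => if w.1 = (fun l => if l ∈ ({x, z} : Finset (Fin k)) then (0 : Fin 2) else 1) then (1 : K) else 0) +
        (fun w => if w.1 = (fun l => if l ∈ ({x, y} : Finset (Fin k)) then (0 : Fin 2) else 1) then (1 : K) else 0) :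
        {v : Fin k → Fin 2 // (∑ i, (v i : ℕ)) + 2 = k * 1} → K) ∈ Submodule.span K (Set.range A.col) := by
    intro x y z hxy hxz hyz
    refine Submodule.subset_span ⟨⟨_, sum_ind_three x y z hxy hxz hyz⟩, funext fun w => ?_⟩
    simp only [Pi.add_apply]; exact col_one_eq x y z hxy hxz hyz w.1
  -- four triple columns on four points give `χ_{ab} − χ_{cd}`
  have hfour : ∀ a b c d : Fin k, a ≠ b → a ≠ c → a ≠ d → b ≠ c → b ≠ d → c ≠ d →
      ((fun w => if w.1 = (fun l => if l ∈ ({a, b} : Finset (Fin k)) then (0 : Fin 2) else 1) then (1 : K) else 0) -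
        (fun w => if w.1 = (fun l => if l ∈ ({c, d} : Finset (Fin k)) then (0 : Fin 2) else 1) then (1 : K) else 0) :
        {v : Fin k → Fin 2 // (∑ i, (v i : ℕ)) + 2 = k * 1} → K) ∈ Submodule.span K (Set.range A.col) :=
    fun a b c d hab hac had hbc hbd hcd =>
      sub_mem_of_four_triples h2 _ (hmem a b c hab hac hbc) (hmem a b d hab had hbd) (hmem a c d hac had hcd) (hmem b c d hbc hbd hcd)
  obtain ⟨P₀⟩ : Nonempty {v : Fin k → Fin 2 // (∑ i, (v i : ℕ)) + 2 = k * 1} := Fintype.card_pos_iff.mp (by rw [card_level]; exact Nat.choose_pos (by omega))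
  -- UPPER: the all-ones row vector is in the left kernel (three `1`s a column)
  have hup : A.rank + 1 ≤ Fintype.card {v : Fin k → Fin 2 // (∑ i, (v i : ℕ)) + 2 = k * 1} := by
    refine rank_add_one_le_card_of_vecMul_eq_zero A (fun _ => 1) (Function.ne_iff.mpr ⟨P₀, one_ne_zero⟩) (funext fun m₀ => ?_)
    obtain ⟨x, y, w, hxy, hxw, hyw, hm⟩ := col_shape_three m₀.1 m₀.2
    show (∑ v, (1 : K) * A v m₀) = 0
    simp_rw [one_mul, hA, Matrix.of_apply, entry_one_eq _ x y w hxy hxw hyw hm, Finset.sum_add_distrib, sum_ite_eq_one _ (sum_ind_two y w hyw),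
      sum_ite_eq_one _ (sum_ind_two x w hxw), sum_ite_eq_one _ (sum_ind_two x y hxy)]
    have e : (1 : K) + 1 + 1 = 3 := by norm_num
    rw [e, h3]
  -- LOWER: every difference of unit row vectors is in the column span
  have hlow : Fintype.card {v : Fin k → Fin 2 // (∑ i, (v i : ℕ)) + 2 = k * 1} ≤ A.rank + 1 := by
    refine card_le_rank_add_one_of_sub_mem A ?_
    rintro ⟨s, hs⟩ ⟨t, ht⟩
    obtain ⟨a, b, hab, rfl⟩ := row_shape_two s hs
    obtain ⟨c, d, hcd, rfl⟩ := row_shape_two t ht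
    rw [single_eq_ind, single_eq_ind]
    by_cases hgen : c ∉ ({a, b} : Finset (Fin k)) ∧ d ∉ ({a, b} : Finset (Fin k))
    · simp only [Finset.mem_insert, Finset.mem_singleton, not_or] at hgen
      exact hfour a b c d hab (Ne.symm hgen.1.1) (Ne.symm hgen.2.1) (Ne.symm hgen.1.2) (Ne.symm hgen.2.2) hcd
    -- the two pairs meet: link them through a pair `{u, w}` outside both (`k ≥ 5`)
    have hT : (insert c (insert d ({a, b} : Finset (Fin k)))).card ≤ 3 := by
      have hab2 : ({a, b} : Finset (Fin k)).card ≤ 2 := Finset.card_le_two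
      rcases not_and_or.mp hgen with hc | hd
      · rw [Finset.insert_eq_of_mem (Finset.mem_insert_of_mem (not_not.mp hc))]; exact (Finset.card_insert_le _ _).trans (by omega)
      · rw [Finset.insert_eq_of_mem (not_not.mp hd)]; exact (Finset.card_insert_le _ _).trans (by omega)
    obtain ⟨u, w, hu, hw, huw⟩ := exists_two_not_mem _ (by omega : (insert c (insert d ({a, b} : Finset (Fin k)))).card + 2 ≤ k)
    simp only [Finset.mem_insert, Finset.mem_singleton, not_or] at hu hw
    obtain ⟨⟨huc, hud, hua, hub⟩, hwc, hwd, hwa, hwb⟩ := And.intro hu hw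
    convert sub_mem (hfour a b u w hab (Ne.symm hua) (Ne.symm hwa) (Ne.symm hub) (Ne.symm hwb) huw)
      (hfour c d u w hcd (Ne.symm huc) (Ne.symm hwc) (Ne.symm hud) (Ne.symm hwd) huw) using 1
    abel
  omega

/-- (N3)  `(3 : K) = 0`, `k ≥ 4`: the multiplicity matrix of `×ℓ² : B_{k−3} → B_{k−1}` (THEOREM (ii) of anchor 179) has rank `card rows − 1`. -/
theorem rank_mulL2_modelC1_d3_char_three (K : Type*) [Field K] (h3 : (3 : K) = 0) (k : ℕ) (hk : 4 ≤ k) :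
    (Matrix.of fun (v : {v : Fin k → Fin 2 // (∑ i, (v i : ℕ)) + 1 = k * 1}) (m : {m : Fin k → Fin 2 // (∑ i, (m i : ℕ)) + 3 = k * 1}) =>
      ((((colR 3 (List.ofFn fun i => (m.1 i : ℕ))).flatMap (colR 3)).count (List.ofFn fun i => (v.1 i : ℕ)) : ℕ) : K)).rank + 1 =
      Fintype.card {v : Fin k → Fin 2 // (∑ i, (v i : ℕ)) + 1 = k * 1} := by
  set A := (Matrix.of fun (v : {v : Fin k → Fin 2 // (∑ i, (v i : ℕ)) + 1 = k * 1}) (m : {m : Fin k → Fin 2 // (∑ i, (m i : ℕ)) + 3 = k * 1}) =>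
      ((((colR 3 (List.ofFn fun i => (m.1 i : ℕ))).flatMap (colR 3)).count (List.ofFn fun i => (v.1 i : ℕ)) : ℕ) : K)) with hA
  have h2 : (2 : K) ≠ 0 := two_ne_zero_of_three_eq_zero h3
  -- the column at the source `x^{𝟙_{xyz}}` is `2(χ_x + χ_y + χ_z)` (as in anchor 179)
  have hmem : ∀ x y z : Fin k, x ≠ y → x ≠ z → y ≠ z →
      ((2 : K) • ((fun w => if w.1 = (fun l => if l ∈ ({x} : Finset (Fin k)) then (0 : Fin 2) else 1) then (1 : K) else 0) +
        (fun w => if w.1 = (fun l => if l ∈ ({y} : Finset (Fin k)) then (0 : Fin 2) else 1) then (1 : K) else 0) +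
        (fun w => if w.1 = (fun l => if l ∈ ({z} : Finset (Fin k)) then (0 : Fin 2) else 1) then (1 : K) else 0)) :
        {v : Fin k → Fin 2 // (∑ i, (v i : ℕ)) + 1 = k * 1} → K) ∈ Submodule.span K (Set.range A.col) := by
    intro x y z hxy hxz hyz
    refine Submodule.subset_span ⟨⟨_, sum_ind_three x y z hxy hxz hyz⟩, funext fun w => ?_⟩
    simp only [Pi.add_apply, Pi.smul_apply]; exact col_two_eq x y z hxy hxz hyz w.1
  obtain ⟨P₀⟩ : Nonempty {v : Fin k → Fin 2 // (∑ i, (v i : ℕ)) + 1 = k * 1} := Fintype.card_pos_iff.mp (by rw [card_level]; exact Nat.choose_pos (by omega))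
  -- UPPER: the all-ones row vector is in the left kernel (column sums `6`)
  have hup : A.rank + 1 ≤ Fintype.card {v : Fin k → Fin 2 // (∑ i, (v i : ℕ)) + 1 = k * 1} := by
    refine rank_add_one_le_card_of_vecMul_eq_zero A (fun _ => 1) (Function.ne_iff.mpr ⟨P₀, one_ne_zero⟩) (funext fun m₀ => ?_)
    obtain ⟨x, y, w, hxy, hxw, hyw, hm⟩ := col_shape_three m₀.1 m₀.2
    show (∑ v, (1 : K) * A v m₀) = 0
    simp_rw [one_mul, hA, Matrix.of_apply, entry_two_eq _ x y w hxy hxw hyw hm, ← Finset.smul_sum, Finset.sum_add_distrib, sum_ite_eq_one _ (sum_ind_one x),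
      sum_ite_eq_one _ (sum_ind_one y), sum_ite_eq_one _ (sum_ind_one w)]
    have e : (2 : K) • ((1 : K) + 1 + 1) = 2 * 3 := by rw [smul_eq_mul]; norm_num
    rw [e, h3, mul_zero]
  -- LOWER: every difference of unit row vectors is in the column span
  have hlow : Fintype.card {v : Fin k → Fin 2 // (∑ i, (v i : ℕ)) + 1 = k * 1} ≤ A.rank + 1 := by
    refine card_le_rank_add_one_of_sub_mem A ?_
    rintro ⟨s, hs⟩ ⟨t, ht⟩
    obtain ⟨d, rfl⟩ := row_shape_one s hs
    obtain ⟨d', rfl⟩ := row_shape_one t ht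
    obtain ⟨a, b, ha, hb, hab⟩ := exists_two_not_mem ({d, d'} : Finset (Fin k)) (by have := Finset.card_le_two (a := d) (b := d'); omega)
    simp only [Finset.mem_insert, Finset.mem_singleton, not_or] at ha hb
    rw [single_eq_ind, single_eq_ind]
    exact sub_mem_of_two_triples h2 _ (hmem a b d hab ha.1 hb.1) (hmem a b d' hab ha.2 hb.2)
  omega

/-! ## THE `d = 3` CELLS IN CHARACTERISTIC `2` (and `×ℓ³` whenever `6 = 0`) -/

/-- (N2)  `(2 : K) = 0`, `k ≥ 1`: the indicator matrix of `×ℓ : B_{k−3} → B_{k−2}` (THEOREM (i) of anchor 179) has rank `card rows − (k − 1)`. -/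
theorem rank_mulL_modelC1_d3_char_two (K : Type*) [Field K] (h2 : (2 : K) = 0) (k : ℕ) (hk : 1 ≤ k) :
    (Matrix.of fun (v : {v : Fin k → Fin 2 // (∑ i, (v i : ℕ)) + 2 = k * 1}) (m : {m : Fin k → Fin 2 // (∑ i, (m i : ℕ)) + 3 = k * 1}) =>
      if List.ofFn (fun i => (v.1 i : ℕ)) ∈ colR 3 (List.ofFn (fun i => (m.1 i : ℕ))) then (1 : K) else 0).rank + (k - 1) =
      Fintype.card {v : Fin k → Fin 2 // (∑ i, (v i : ℕ)) + 2 = k * 1} := by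
  set A := (Matrix.of fun (v : {v : Fin k → Fin 2 // (∑ i, (v i : ℕ)) + 2 = k * 1}) (m : {m : Fin k → Fin 2 // (∑ i, (m i : ℕ)) + 3 = k * 1}) =>
      if List.ofFn (fun i => (v.1 i : ℕ)) ∈ colR 3 (List.ofFn (fun i => (m.1 i : ℕ))) then (1 : K) else 0) with hA
  obtain ⟨z⟩ := Fin.pos_iff_nonempty.mp hk
  -- the column at the source `x^{𝟙_{xyw}}` is `χ_{yw} + χ_{xw} + χ_{xy}` (as in anchor 179)
  have hmem : ∀ x y w : Fin k, x ≠ y → x ≠ w → y ≠ w →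
      ((fun r => if r.1 = (fun l => if l ∈ ({y, w} : Finset (Fin k)) then (0 : Fin 2) else 1) then (1 : K) else 0) +
        (fun r => if r.1 = (fun l => if l ∈ ({x, w} : Finset (Fin k)) then (0 : Fin 2) else 1) then (1 : K) else 0) +
        (fun r => if r.1 = (fun l => if l ∈ ({x, y} : Finset (Fin k)) then (0 : Fin 2) else 1) then (1 : K) else 0) :
        {v : Fin k → Fin 2 // (∑ i, (v i : ℕ)) + 2 = k * 1} → K) ∈ Submodule.span K (Set.range A.col) := by
    intro x y w hxy hxw hyw
    refine Submodule.subset_span ⟨⟨_, sum_ind_three x y w hxy hxw hyw⟩, funext fun r => ?_⟩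
    simp only [Pi.add_apply]; exact col_one_eq x y w hxy hxw hyw r.1
  -- UPPER: the `k − 1` vectors `y^a = Σ_{P ∋ a} e_P`, `a ≠ z`, are independent left-kernel vectors
  have hup : A.rank + Fintype.card {a : Fin k // a ≠ z} ≤ Fintype.card {v : Fin k → Fin 2 // (∑ i, (v i : ℕ)) + 2 = k * 1} := by
    refine rank_add_card_le_of_vecMul_eq_zero (ι := {a : Fin k // a ≠ z}) A (fun a v => if v.1 a.1 = 0 then (1 : K) else 0) ?_ fun a => ?_
    · refine linearIndependent_of_apply_ne_zero _
        (fun a => ⟨fun l => if l ∈ ({a.1, z} : Finset (Fin k)) then 0 else 1, sum_ind_two a.1 z a.2⟩) (fun a => by simp) fun a b hba => ?_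
      have hne : b.1 ≠ a.1 := fun h => hba (Subtype.ext h)
      simp [hne, b.2]
    · funext m₀
      obtain ⟨x, y, w, hxy, hxw, hyw, hm⟩ := col_shape_three m₀.1 m₀.2
      show (∑ v, (if v.1 a.1 = 0 then (1 : K) else 0) * A v m₀) = 0
      simp_rw [hA, Matrix.of_apply, entry_one_eq _ x y w hxy hxw hyw hm, mul_add, Finset.sum_add_distrib, sum_mul_ite_eq _ _ (sum_ind_two y w hyw),
        sum_mul_ite_eq _ _ (sum_ind_two x w hxw), sum_mul_ite_eq _ _ (sum_ind_two x y hxy)]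
      by_cases hx : a.1 = x
      · subst hx; simp [hxy, hxw, one_add_one_eq_two, h2]
      by_cases hy : a.1 = y
      · subst hy; simp [hxy.symm, hyw, one_add_one_eq_two, h2]
      by_cases hw : a.1 = w
      · subst hw; simp [hxw.symm, hyw.symm, one_add_one_eq_two, h2]
      simp [hx, hy, hw]
  -- LOWER: with the `k − 1` hub vectors `e_{{a,z}}`, `a ≠ z`, the columns span everything
  have hlow : Fintype.card {v : Fin k → Fin 2 // (∑ i, (v i : ℕ)) + 2 = k * 1} ≤ A.rank + Fintype.card {a : Fin k // a ≠ z} := by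
    let hub : {a : Fin k // a ≠ z} → ({v : Fin k → Fin 2 // (∑ i, (v i : ℕ)) + 2 = k * 1} → K) := fun a =>
      Pi.single (⟨fun l => if l ∈ ({a.1, z} : Finset (Fin k)) then 0 else 1, sum_ind_two a.1 z a.2⟩ : {v : Fin k → Fin 2 // (∑ i, (v i : ℕ)) + 2 = k * 1}) 1
    have hH : ∀ (c : Fin k) (hc : c ≠ z), (fun r => if r.1 = (fun l => if l ∈ ({c, z} : Finset (Fin k)) then (0 : Fin 2) else 1) then (1 : K) else 0) ∈
        Submodule.span K (Set.range hub) := fun c hc => Submodule.subset_span ⟨⟨c, hc⟩, single_eq_ind _ _⟩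
    refine card_le_rank_add_card_of_single_mem_sup A hub ?_
    rintro ⟨s, hs⟩
    obtain ⟨a, b, hab, rfl⟩ := row_shape_two s hs
    by_cases haz : a = z
    · subst haz
      refine Submodule.mem_sup_right (Submodule.subset_span ⟨⟨b, hab.symm⟩, congrArg (fun r => (Pi.single r (1 : K) : _ → K)) ?_⟩)
      exact Subtype.ext (by dsimp only; rw [Finset.pair_comm])
    by_cases hbz : b = z
    · subst hbz; exact Submodule.mem_sup_right (Submodule.subset_span ⟨⟨a, haz⟩, rfl⟩)
    rw [single_eq_ind]
    convert sub_mem (sub_mem (Submodule.mem_sup_left (T := Submodule.span K (Set.range hub)) (hmem a b z hab haz hbz))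
      (Submodule.mem_sup_right (S := Submodule.span K (Set.range A.col)) (hH b hbz)))
      (Submodule.mem_sup_right (S := Submodule.span K (Set.range A.col)) (hH a haz)) using 1
    abel
  have hcard : Fintype.card {a : Fin k // a ≠ z} = k - 1 := card_ne_eq z; omega

/-- (N4)  `(2 : K) = 0`, every `k`: the multiplicity matrix of `×ℓ² : B_{k−3} → B_{k−1}` (THEOREM (ii) of anchor 179) is `0` (`ℓ² = 2·e₂(x)`). -/
theorem mulL2_modelC1_d3_char_two (K : Type*) [Field K] (h2 : (2 : K) = 0) (k : ℕ) :
    (Matrix.of fun (v : {v : Fin k → Fin 2 // (∑ i, (v i : ℕ)) + 1 = k * 1}) (m : {m : Fin k → Fin 2 // (∑ i, (m i : ℕ)) + 3 = k * 1}) =>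
      ((((colR 3 (List.ofFn fun i => (m.1 i : ℕ))).flatMap (colR 3)).count (List.ofFn fun i => (v.1 i : ℕ)) : ℕ) : K)) = 0 := by
  ext v m₀
  obtain ⟨x, y, w, hxy, hxw, hyw, hm⟩ := col_shape_three m₀.1 m₀.2
  rw [Matrix.of_apply, Matrix.zero_apply, entry_two_eq _ x y w hxy hxw hyw hm, h2, zero_smul]

/-- (N5)  `(6 : K) = 0` (characteristic `2` or `3`), every `k`: the multiplicity matrix of `×ℓ³ : B_{k−3} → B_k` (THEOREM (iii) of anchor 179) is `0`. -/
theorem mulL3_modelC1_d3_six (K : Type*) [Field K] (h6 : (6 : K) = 0) (k : ℕ) :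
    (Matrix.of fun (v : {v : Fin k → Fin 2 // (∑ i, (v i : ℕ)) = k * 1}) (m : {m : Fin k → Fin 2 // (∑ i, (m i : ℕ)) + 3 = k * 1}) =>
      (((((colR 3 (List.ofFn fun i => (m.1 i : ℕ))).flatMap (colR 3)).flatMap (colR 3)).count (List.ofFn fun i => (v.1 i : ℕ)) : ℕ) : K)) = 0 := by
  ext ⟨v, hv⟩ ⟨m, hm⟩
  obtain ⟨a, b, c, hab, hac, hbc, rfl⟩ := col_shape_three m hm
  obtain rfl := row_shape_zero v hv
  rw [Matrix.of_apply, Matrix.zero_apply]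
  exact (congrArg (Nat.cast : ℕ → K) (count_flatMap3_all a b c hab hac hbc)).trans (by exact_mod_cast h6)

end Summit.HodgeConjecture.HodgeConjecture.HodgeLocus.Census.UnitColumnRankD3Deficit
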